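import Mathlib.RingTheory.Norm.Basic
import Mathlib.RingTheory.TensorProduct.Free
import Mathlib.FieldTheory.IsAlgClosed.Basic
import Mathlib.Algebra.MvPolynomial.Funext
import Mathlib.RingTheory.Artinian.Module
import HarnessLib

/-!
# Norm forms of finite free algebras

Commutative algebra used in the descent of projectivity along a finite extension of the base
field (`Motives/ProjectiveDescentFinite`): for a commutative `R`-algebra `B`, free of finite rank
with basis `e`, and a finite family `u : Λ → B`, the **norm form**
`N(∑_λ X_λ u_λ) := det (∑_λ X_λ M(u_λ)) ∈ R[X_λ : λ ∈ Λ]` (`Literature.AlgebraicGeometry.Motives.ProjectiveDescent.normForm`;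
`M(b)` the matrix of multiplication by `b`, Mathlib `Algebra.leftMulMatrix`), i.e. the norm of
the generic linear combination of the `u_λ`. This is the polynomial classically attached to a
finite flat covering `π : X' → X` and sections `u_λ` upstairs (the norm `N_{X'/X}`, as in the proof
that the norm of an ample line bundle along a finite locally free surjection is ample,
Görtz–Wedhorn I, Prop. 13.76; EGA II 6.6); here only the algebra is developed:

* `map_normForm`, `map_normForm_eq`, `map_norm_eq`: functoriality in ring homomorphisms and in
  based morphisms of free algebras (restriction to smaller opens downstairs);
* `normForm_mul`: `N(∑ X_λ φu_λ) = N(φ) · N(∑ X_λ u_λ)` (change of trivialisation);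
* `eval_normForm_single_of_eq_one`: the norm form of a family containing `1` does not vanish;
* `isUnit_norm_iff`: an element of a finite free algebra is a unit iff its norm is;
* `eval_map_normForm_eq_zero_iff` (**zero criterion**): over an algebraically closed field `K`
  (an `R`-algebra), `N(∑ x_λ u_λ) = 0` at `x ∈ K^Λ` iff some `R`-algebra homomorphism
  `ψ : B → K` kills `∑ x_λ u_λ` — the norm of an element of the finite-dimensional `K`-algebra
  `K ⊗_R B` vanishes iff the element is a non-unit, iff it lies in a maximal ideal, whose
  residue field is `K`; geometrically: a norm vanishes at a point iff the function vanishes at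
  some point of the fibre;
* `finite_algHom`, `nonempty_algHom`: the fibre `{ψ : B →ₐ[R] K}` is finite and non-empty;
* `mem_of_forall_orthogonal` (**hyperplane lemma**): over an infinite field, a vector `v` with
  `v λ₀ = 1` such that every `x ⟂ v` is orthogonal to a member of a finite set `S` of such vectors
  belongs to `S` (a vector space over an infinite field is not a finite union of proper
  subspaces, here via `MvPolynomial.funext`).

## References

* U. Görtz, T. Wedhorn, *Algebraic Geometry I: Schemes*, 2nd ed., Springer Spektrum (2020),
  doi:10.1007/978-3-658-30733-2: Prop. 13.76, p. 513 (norms of line bundles along finite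
  locally free morphisms), (12.6), p. 333 (norm of a finite locally free algebra).
  [GortzWedhorn2020]
* N. Bourbaki, *Algebra II*, Ch. III §9 (norms and determinants of endomorphisms of free
  modules). [folklore]
-/

open MvPolynomial Algebra TensorProduct

noncomputable section

namespace Literature.AlgebraicGeometry.Motives

namespace ProjectiveDescent

section NormForm

variable {R : Type*} [CommRing R] {B : Type*} [CommRing B] [Algebra R B]
  {m : Type*} [Fintype m] [DecidableEq m] (e : Module.Basis m R B)
  {Λ : Type*} [Fintype Λ] (u : Λ → B)

/-- The matrix `∑_λ X_λ · M(u λ)` over `R[X_λ : λ ∈ Λ]`, where `M(b)` is the matrix of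
multiplication by `b` in the basis `e`. [folklore] -/
def normMatrix : Matrix m m (MvPolynomial Λ R) :=
  Matrix.of fun i j => ∑ l, X l * C (leftMulMatrix e (u l) i j)

/-- The **norm form** of the family `u`: `N(∑_λ X_λ u_λ) = det (∑_λ X_λ M(u λ)) ∈ R[X_λ]`, the norm
of the generic linear combination of the `u λ`. [folklore] -/
def normForm : MvPolynomial Λ R :=
  (normMatrix e u).det

/-- The entries of `normMatrix`. [folklore] -/
theorem normMatrix_apply (i j : m) :
    normMatrix e u i j = ∑ l, X l * C (leftMulMatrix e (u l) i j) := rfl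

/-- The image of the norm form under a ring homomorphism out of `R[X_λ]` is the determinant of
the image matrix. [folklore] -/
theorem map_normForm {S : Type*} [CommRing S] (f : MvPolynomial Λ R →+* S) :
    f (normForm e u) =
      (Matrix.of fun i j => ∑ l, f (X l) * f (C (leftMulMatrix e (u l) i j))).det := by
  rw [normForm, RingHom.map_det, RingHom.mapMatrix_apply]
  congr 1
  refine Matrix.ext fun i j => ?_
  simp only [Matrix.map_apply, Matrix.of_apply, normMatrix_apply, map_sum, map_mul]

/-- Evaluating the norm form at the `λ₀`-th coordinate vector gives the norm of `u λ₀`.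
[folklore] -/
theorem eval_normForm_single [DecidableEq Λ] (l₀ : Λ) :
    eval (Pi.single l₀ 1 : Λ → R) (normForm e u) = Algebra.norm R (u l₀) := by
  rw [map_normForm, Algebra.norm_eq_matrix_det e]
  congr 1
  refine Matrix.ext fun i j => ?_
  simp only [Matrix.of_apply, eval_X, eval_C]
  rw [Finset.sum_eq_single l₀]
  · simp
  · intro l _ hl
    simp [Pi.single_eq_of_ne hl]
  · intro h
    exact absurd (Finset.mem_univ l₀) h

/-- In particular the norm form of a family containing `1` takes the value `1` at the
corresponding coordinate vector (so it is a non-zero polynomial, and stays non-zero under every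
extension of scalars). [folklore] -/
theorem eval_normForm_single_of_eq_one [DecidableEq Λ] (l₀ : Λ) (h : u l₀ = 1) :
    eval (Pi.single l₀ 1 : Λ → R) (normForm e u) = 1 := by
  rw [eval_normForm_single, h, map_one]

/-- **Multiplicativity**: multiplying the whole family by `φ` multiplies the norm form by the
constant `N(φ)`. [folklore] -/
theorem normForm_mul (φ : B) :
    normForm e (fun l => φ * u l) = C (Algebra.norm R φ) * normForm e u := by
  have hmat : normMatrix e (fun l => φ * u l) =
      (leftMulMatrix e φ).map C * normMatrix e u := by
    refine Matrix.ext fun i j => ?_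
    rw [normMatrix_apply, Matrix.mul_apply]
    change ∑ l, X l * C (leftMulMatrix e (φ * u l) i j) =
      ∑ k, C (leftMulMatrix e φ i k) * ∑ l, X l * C (leftMulMatrix e (u l) k j)
    simp only [map_mul, Matrix.mul_apply, map_sum, Finset.mul_sum]
    rw [Finset.sum_comm]
    refine Finset.sum_congr rfl fun k _ => Finset.sum_congr rfl fun l _ => ?_
    ring
  rw [normForm, normForm, hmat, Matrix.det_mul, Algebra.norm_eq_matrix_det e,
    RingHom.map_det, RingHom.mapMatrix_apply]

/-- **Functoriality of multiplication matrices**: a pair of ring homomorphisms `ρ_R : R → R'`,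
`ρ_B : B → B'` compatible with the algebra structures and mapping the basis `e` to the basis
`e'` maps multiplication matrices to multiplication matrices. [folklore] -/
theorem leftMulMatrix_map {R' : Type*} [CommRing R'] {B' : Type*} [CommRing B'] [Algebra R' B']
    (e' : Module.Basis m R' B') (ρR : R →+* R') (ρB : B →+* B')
    (hρ : ∀ r, ρB (algebraMap R B r) = algebraMap R' B' (ρR r)) (he : ∀ i, ρB (e i) = e' i)
    (b : B) : leftMulMatrix e' (ρB b) = (leftMulMatrix e b).map ρR := by
  refine Matrix.ext fun i j => ?_
  rw [Matrix.map_apply, leftMulMatrix_eq_repr_mul, leftMulMatrix_eq_repr_mul, ← he j, ← map_mul]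
  conv_lhs => rw [← e.sum_repr (b * e j)]
  rw [map_sum]
  simp_rw [Algebra.smul_def, map_mul, hρ, he, ← Algebra.smul_def]
  rw [map_sum]
  simp_rw [map_smul, e'.repr_self, Finsupp.smul_single, smul_eq_mul, mul_one,
    Finsupp.finsetSum_apply, Finsupp.single_apply]
  rw [Finset.sum_ite_eq']
  simp

/-- Functoriality of the norm form under a based morphism of finite free algebras. [folklore] -/
theorem map_normForm_eq {R' : Type*} [CommRing R'] {B' : Type*} [CommRing B'] [Algebra R' B']
    (e' : Module.Basis m R' B') (ρR : R →+* R') (ρB : B →+* B')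
    (hρ : ∀ r, ρB (algebraMap R B r) = algebraMap R' B' (ρR r)) (he : ∀ i, ρB (e i) = e' i) :
    MvPolynomial.map ρR (normForm e u) = normForm e' (fun l => ρB (u l)) := by
  rw [map_normForm, normForm]
  congr 1
  refine Matrix.ext fun i j => ?_
  simp only [Matrix.of_apply, map_X, map_C, normMatrix_apply,
    leftMulMatrix_map e e' ρR ρB hρ he, Matrix.map_apply]

/-- The norm along a based morphism of finite free algebras. [folklore] -/
theorem map_norm_eq {R' : Type*} [CommRing R'] {B' : Type*} [CommRing B'] [Algebra R' B']
    (e' : Module.Basis m R' B') (ρR : R →+* R') (ρB : B →+* B')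
    (hρ : ∀ r, ρB (algebraMap R B r) = algebraMap R' B' (ρR r)) (he : ∀ i, ρB (e i) = e' i)
    (b : B) : ρR (Algebra.norm R b) = Algebra.norm R' (ρB b) := by
  rw [Algebra.norm_eq_matrix_det e, Algebra.norm_eq_matrix_det e', RingHom.map_det,
    RingHom.mapMatrix_apply, leftMulMatrix_map e e' ρR ρB hρ he]

omit [Fintype m] [DecidableEq m] e in
/-- In a finite free algebra an element is a unit iff its norm is a unit. [folklore] -/
theorem isUnit_norm_iff [Module.Free R B] [Module.Finite R B] (b : B) :
    IsUnit (Algebra.norm R b) ↔ IsUnit b := by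
  rw [Algebra.norm_apply, ← LinearMap.isUnit_iff_isUnit_det, Algebra.lmul_isUnit_iff]

end NormForm

/-! ### The zero criterion over an algebraically closed field -/

section ZeroCriterion

variable {R : Type*} [CommRing R] {B : Type*} [CommRing B] [Algebra R B]
  {m : Type*} [Fintype m] [DecidableEq m] (e : Module.Basis m R B)
  {Λ : Type*} [Fintype Λ] (u : Λ → B)
  (K : Type*) [Field K] [Algebra R K]

/-- The norm form, extended to `K` and evaluated at `x ∈ K^Λ`, is the norm of the element
`∑_λ x_λ ⊗ u_λ` of the finite-dimensional `K`-algebra `K ⊗_R B`. [folklore] -/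
theorem eval_map_normForm (x : Λ → K) :
    eval x (MvPolynomial.map (algebraMap R K) (normForm e u)) =
      Algebra.norm K (∑ l, x l ⊗ₜ[R] u l : K ⊗[R] B) := by
  rw [eval_map, ← coe_eval₂Hom, map_normForm,
    Algebra.norm_eq_matrix_det (Algebra.TensorProduct.basis K e)]
  congr 1
  refine Matrix.ext fun i j => ?_
  simp only [Matrix.of_apply, coe_eval₂Hom, eval₂_X, eval₂_C, leftMulMatrix_eq_repr_mul,
    Algebra.TensorProduct.basis_apply, Finset.sum_mul, Algebra.TensorProduct.tmul_mul_tmul,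
    mul_one, map_sum, Algebra.TensorProduct.basis_repr_tmul, Finsupp.coe_finsetSum,
    Finset.sum_apply, Finsupp.coe_smul, Pi.smul_apply, Finsupp.mapRange_apply, smul_eq_mul]

/-- A non-unit of a finite-dimensional commutative algebra over an algebraically closed field
`K` is killed by some `K`-algebra homomorphism to `K` (its residue fields are finite over `K`,
hence equal to `K`). [folklore] -/
theorem exists_algHom_apply_eq_zero [IsAlgClosed K] {A : Type*} [CommRing A] [Algebra K A]
    [Module.Finite K A] {a : A} (ha : ¬IsUnit a) : ∃ χ : A →ₐ[K] K, χ a = 0 := by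
  obtain ⟨M, hM, haM⟩ := Ideal.exists_le_maximal (Ideal.span {a})
    (by rwa [Ne, Ideal.span_singleton_eq_top])
  haveI : M.IsMaximal := hM
  haveI : Module.Finite K (A ⧸ M) :=
    Module.Finite.of_surjective (Ideal.Quotient.mkₐ K M).toLinearMap
      (Ideal.Quotient.mkₐ_surjective K M)
  haveI : Algebra.IsIntegral K (A ⧸ M) := Algebra.IsIntegral.of_finite K _
  have hbij := IsAlgClosed.algebraMap_bijective_of_isIntegral (k := K) (K := A ⧸ M)
  let ε : K ≃ₐ[K] A ⧸ M := AlgEquiv.ofBijective (Algebra.ofId K (A ⧸ M)) hbij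
  refine ⟨(ε.symm : A ⧸ M →ₐ[K] K).comp (Ideal.Quotient.mkₐ K M), ?_⟩
  have h0 : Ideal.Quotient.mkₐ K M a = 0 :=
    Ideal.Quotient.eq_zero_iff_mem.mpr (haM (Ideal.subset_span rfl))
  rw [AlgHom.comp_apply, h0, map_zero]

/-- **Zero criterion for the norm form.** Over an algebraically closed field `K` (an
`R`-algebra), the norm form of `u` vanishes at `x ∈ K^Λ` iff some `R`-algebra homomorphism
`ψ : B → K` kills `∑_λ x_λ u_λ`, i.e. `∑_λ x_λ ψ(u_λ) = 0`: the value is the norm of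
`y = ∑ x_λ ⊗ u_λ ∈ K ⊗_R B`, which vanishes iff `y` is a non-unit, iff `y` lies in a maximal
ideal, whose residue field is `K`; and `K`-algebra homomorphisms `K ⊗_R B → K` are the
`R`-algebra homomorphisms `B → K`. [folklore] -/
theorem eval_map_normForm_eq_zero_iff [IsAlgClosed K] (x : Λ → K) :
    eval x (MvPolynomial.map (algebraMap R K) (normForm e u)) = 0 ↔
      ∃ ψ : B →ₐ[R] K, ∑ l, x l * ψ (u l) = 0 := by
  haveI := Module.Finite.of_basis (Algebra.TensorProduct.basis K e)
  haveI := Module.Free.of_basis (Algebra.TensorProduct.basis K e)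
  rw [eval_map_normForm]
  set y : K ⊗[R] B := ∑ l, x l ⊗ₜ[R] u l with hy
  have h1 : Algebra.norm K y = 0 ↔ ¬IsUnit y := by
    rw [← isUnit_norm_iff (R := K) y, isUnit_iff_ne_zero, not_not]
  rw [h1]
  constructor
  · intro hu
    obtain ⟨χ, hχ⟩ := exists_algHom_apply_eq_zero K hu
    refine ⟨(χ.restrictScalars R).comp Algebra.TensorProduct.includeRight, ?_⟩
    have : χ y = ∑ l, x l * χ (1 ⊗ₜ[R] u l) := by
      rw [hy, map_sum]
      refine Finset.sum_congr rfl fun l _ => ?_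
      rw [show x l ⊗ₜ[R] u l = x l • ((1 : K) ⊗ₜ[R] u l) by
        rw [TensorProduct.smul_tmul', smul_eq_mul, mul_one], map_smul, smul_eq_mul]
    rw [this] at hχ
    simpa using hχ
  · rintro ⟨ψ, hψ⟩ hunit
    let χ : K ⊗[R] B →ₐ[K] K :=
      Algebra.TensorProduct.lift (AlgHom.id K K) ψ fun _ _ => Commute.all _ _
    have hχy : χ y = 0 := by
      rw [hy, map_sum]
      simpa [χ, Algebra.TensorProduct.lift_tmul] using hψ
    exact (hunit.map χ).ne_zero hχy

omit [Fintype m] [DecidableEq m] e in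
/-- Over any field `K`, a finite free `R`-algebra `B` has only finitely many `R`-algebra
homomorphisms to `K`: they correspond to maximal ideals of the artinian ring `K ⊗_R B`.
[folklore] -/
theorem finite_algHom [Module.Free R B] [Module.Finite R B] : Finite (B →ₐ[R] K) := by
  haveI : IsArtinianRing (K ⊗[R] B) := IsArtinianRing.of_finite K _
  -- `ψ ↦ ker (K ⊗ B → K)` is injective into the finite maximal spectrum
  let χ : (B →ₐ[R] K) → (K ⊗[R] B →ₐ[K] K) := fun ψ =>
    Algebra.TensorProduct.lift (AlgHom.id K K) ψ fun _ _ => Commute.all _ _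
  have hχ : ∀ ψ b, χ ψ (1 ⊗ₜ b) = ψ b := fun ψ b => by
    simp [χ, Algebra.TensorProduct.lift_tmul]
  let κ : (B →ₐ[R] K) → MaximalSpectrum (K ⊗[R] B) := fun ψ =>
    ⟨RingHom.ker (χ ψ).toRingHom, RingHom.ker_isMaximal_of_surjective _ fun c =>
      ⟨algebraMap K _ c, (χ ψ).commutes c⟩⟩
  refine Finite.of_injective κ fun ψ₁ ψ₂ h => ?_
  have hker : RingHom.ker (χ ψ₁).toRingHom = RingHom.ker (χ ψ₂).toRingHom :=
    congrArg MaximalSpectrum.asIdeal h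
  ext b
  have hmem : (1 : K) ⊗ₜ[R] b - algebraMap K _ (ψ₁ b) ∈ RingHom.ker (χ ψ₂).toRingHom := by
    rw [← hker, RingHom.mem_ker]
    change χ ψ₁ (_ - _) = 0
    rw [map_sub, hχ, AlgHom.commutes, Algebra.algebraMap_self_apply, sub_self]
  rw [RingHom.mem_ker] at hmem
  change χ ψ₂ (_ - _) = 0 at hmem
  rw [map_sub, hχ, AlgHom.commutes, Algebra.algebraMap_self_apply, sub_eq_zero] at hmem
  exact hmem.symm

omit [DecidableEq m] in
include e in
/-- A non-zero finite free `R`-algebra admits an `R`-algebra homomorphism to any algebraically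
closed field `K` over `R`. [folklore] -/
theorem nonempty_algHom [IsAlgClosed K] [Nonempty m] : Nonempty (B →ₐ[R] K) := by
  haveI := Module.Finite.of_basis (Algebra.TensorProduct.basis K e)
  have h0 : ¬IsUnit (0 : K ⊗[R] B) := by
    intro h
    obtain ⟨i⟩ := ‹Nonempty m›
    haveI : Nontrivial (K ⊗[R] B) :=
      ⟨⟨_, _, (Algebra.TensorProduct.basis K e).ne_zero i⟩⟩
    exact not_isUnit_zero h
  obtain ⟨χ, -⟩ := exists_algHom_apply_eq_zero K h0
  exact ⟨(χ.restrictScalars R).comp Algebra.TensorProduct.includeRight⟩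

end ZeroCriterion

/-! ### A vector recognised by its hyperplane -/

section Hyperplane

variable {K : Type*} [Field K] [Infinite K] {Λ : Type*} [Fintype Λ] [DecidableEq Λ]

/-- **Hyperplane lemma.** Let `K` be an infinite field, `v ∈ K^Λ` with `v λ₀ = 1`, and `S` a
finite set of vectors `w` with `w λ₀ = 1`. If every `x` orthogonal to `v` is orthogonal to some
`w ∈ S`, then `v ∈ S`. (Otherwise the product over `w ∈ S` of the non-zero linear forms
`∑_{λ} (v_λ - w_λ) X_λ` is a non-zero polynomial, so it does not vanish at some `a ∈ K^Λ`;
correcting `a` in the `λ₀`-coordinate to make it orthogonal to `v` contradicts the hypothesis.)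
[folklore] -/
theorem mem_of_forall_orthogonal (l₀ : Λ) (v : Λ → K) (hv : v l₀ = 1) (S : Set (Λ → K))
    (hS : S.Finite) (hS1 : ∀ w ∈ S, w l₀ = 1)
    (H : ∀ x : Λ → K, ∑ l, x l * v l = 0 → ∃ w ∈ S, ∑ l, x l * w l = 0) : v ∈ S := by
  by_contra hvS
  -- the product of the linear forms `∑ (v - w) X`
  let L : (Λ → K) → MvPolynomial Λ K := fun w => ∑ l, C (v l - w l) * X l
  have hL : ∀ w ∈ S, L w ≠ 0 := by
    intro w hw h0
    have hne : v ≠ w := fun h => hvS (h ▸ hw)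
    obtain ⟨l₁, hl₁⟩ : ∃ l, v l ≠ w l := by
      by_contra! h
      exact hne (funext h)
    have hc : coeff (Finsupp.single l₁ 1) (L w) = v l₁ - w l₁ := by
      simp only [L, coeff_sum, coeff_C_mul, coeff_X, mul_ite, mul_one, mul_zero]
      rw [Finset.sum_eq_single l₁]
      · simp
      · intro l _ hl
        rw [if_neg]
        intro h
        exact hl (Finsupp.single_left_injective one_ne_zero h)
      · intro h; exact absurd (Finset.mem_univ l₁) h
    rw [h0, coeff_zero] at hc
    exact hl₁ (sub_eq_zero.mp hc.symm)
  have hprod : ∏ w ∈ hS.toFinset, L w ≠ 0 :=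
    Finset.prod_ne_zero_iff.mpr fun w hw => hL w (hS.mem_toFinset.mp hw)
  -- a point where the product does not vanish
  obtain ⟨a, ha⟩ : ∃ a : Λ → K, eval a (∏ w ∈ hS.toFinset, L w) ≠ 0 := by
    by_contra! h
    exact hprod (MvPolynomial.funext fun a => by rw [h a, map_zero])
  rw [map_prod] at ha
  have ha' : ∀ w ∈ S, ∑ l, (v l - w l) * a l ≠ 0 := by
    intro w hw
    have := Finset.prod_ne_zero_iff.mp ha w (hS.mem_toFinset.mpr hw)
    simpa [L, map_sum, eval_C, eval_X] using this
  -- correct `a` in the `λ₀`-coordinate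
  let x : Λ → K := a - (∑ l, a l * v l) • Pi.single l₀ 1
  have hx : ∀ w : Λ → K, w l₀ = 1 → ∑ l, x l * w l = ∑ l, a l * w l - ∑ l, a l * v l := by
    intro w hw
    simp only [x, Pi.sub_apply, Pi.smul_apply, smul_eq_mul, sub_mul, Finset.sum_sub_distrib]
    congr 1
    rw [Finset.sum_eq_single l₀]
    · simp [hw]
    · intro l _ hl
      simp [Pi.single_eq_of_ne hl]
    · intro h; exact absurd (Finset.mem_univ l₀) h
  obtain ⟨w, hwS, hw⟩ := H x (by rw [hx v hv, sub_self])
  rw [hx w (hS1 w hwS)] at hw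
  apply ha' w hwS
  rw [← neg_eq_zero, ← hw]
  simp only [sub_mul, Finset.sum_sub_distrib, neg_sub]
  congr 1 <;> exact Finset.sum_congr rfl fun l _ => mul_comm _ _

end Hyperplane

end ProjectiveDescent

end Literature.AlgebraicGeometry.Motives
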